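import Literature.Combinatorics.StablePolynomials.UnivariateStabilityPreservers
import Mathlib.Algebra.Polynomial.Basis
import HarnessLib

/-!
# The Schur–Maló–Szegő composition theorem (via Borcea–Brändén I, Theorem 1.1 for `n = 1`)

J. Borcea, P. Brändén, *The Lee–Yang and Pólya–Schur programs. II. Theory of stable polynomials and
applications*, Comm. Pure Appl. Math. 62 (2009) 1595–1631 (arXiv:0809.3087), §3, Example 1:

> Let us show how the classical (univariate) Schur–Maló–Szegő theorem can be easily derived … If
> `Σ_{k=0}^n binom(n,k) a_k z^k` and `Σ_{k=0}^n binom(n,k) b_k z^k` are two polynomials with real zeros only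
> and in addition all the zeros of the latter polynomial are non-positive then … the Schur–Maló–Szegő
> composition of the two given polynomials, i.e., the univariate polynomial `Σ_{k=0}^n binom(n,k) a_k b_k z^k`
> is also stable (that is, real-rooted).

The paper derives this from its "master composition theorem" (Cor. 3.4 (a)); here it is obtained directly
from the algebraic characterisation of stability preservers on `ℂ_n[t]` (Borcea–Brändén I, Thm. 1.1 for
`n = 1`, tree `boundedDegree_stabilityPreserver_iff`, `UnivariateStabilityPreservers.lean`) applied to the
diagonal operator `Λ_b : t^k ↦ b_k t^k` (`multiplierOp`): its symbol is
`G_{Λ_b}(z,w) = Σ_k binom(n,k) b_k z^k w^{n-k} = w^n q(z/w)` with `q(t) = Σ_k binom(n,k) b_k t^k`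
(`eval_multiplierOp_X_add_C_pow`), which has no zeros with `Im z, Im w > 0` as soon as all zeros of `q` are
real and `≤ 0` (then `z/w ≤ 0` is impossible; `symbol_multiplierOp_ne_zero`). Hence `Λ_b` maps stable
polynomials of degree `≤ n` to stable polynomials or `0` (`multiplierOp_stable_or_zero`), and a real
polynomial without zeros in the open upper half-plane has only real zeros (`im_eq_zero_of_eval_eq_zero`),
which gives the theorem (`schur_malo_szego`) — with the alternative "or identically zero", which the operator
statement carries (e.g. `a = (1,0)`, `b = (0,1)`, `n = 1` give the zero polynomial).

## Contents

* `binomialForm n c = Σ_{k≤n} binom(n,k) c_k t^k`, `multiplierOp b = Λ_b`.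
* `eval_multiplierOp_X_add_C_pow`, `symbol_multiplierOp_ne_zero`, **`multiplierOp_stable_or_zero`**
  (`Λ_b` preserves stability on `ℂ_n[t]` when `q` has only real non-positive zeros).
* **`schur_malo_szego`** (the classical theorem, real coefficients).

## References

* [BorceaBranden2009II] J. Borcea, P. Brändén, Comm. Pure Appl. Math. 62 (2009) 1595–1631, §3 Example 1
  (Schur–Maló–Szegő), Cor. 3.4.
* [BorceaBranden2009] J. Borcea, P. Brändén, Invent. Math. 177 (2009) 541–569, §1.1 Thm. 1.1.
-/

noncomputable section

open MvPolynomial Finset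

namespace Literature.Combinatorics.StablePolynomials

/-! ## §1 The binomial form and the diagonal operator `Λ_b` -/

section Multiplier

/-- **The binomially weighted polynomial `Σ_{k ≤ n} binom(n,k) c_k t^k`.** [cite: BorceaBranden2009II, §3
Example 1 ("`Σ_{k=0}^n binom(n,k) a_k z^k`")] -/
def binomialForm {R : Type*} [CommSemiring R] (n : ℕ) (c : ℕ → R) : Polynomial R :=
  ∑ k ∈ range (n + 1), Polynomial.C (((n.choose k : ℕ) : R) * c k) * Polynomial.X ^ k

/-- `binomialForm n c` has degree `≤ n`. [cite: BorceaBranden2009II, §3 Example 1] -/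
theorem natDegree_binomialForm_le {R : Type*} [CommSemiring R] (n : ℕ) (c : ℕ → R) :
    (binomialForm n c).natDegree ≤ n :=
  Polynomial.natDegree_sum_le_of_forall_le _ _ fun _ hk =>
    (Polynomial.natDegree_C_mul_X_pow_le _ _).trans (Nat.lt_succ_iff.1 (mem_range.1 hk))

/-- Complexifying a real binomial form. [cite: BorceaBranden2009II, §3 Example 1] -/
theorem map_binomialForm (n : ℕ) (c : ℕ → ℝ) :
    (binomialForm n c).map (algebraMap ℝ ℂ) = binomialForm n fun k => (c k : ℂ) := by
  rw [binomialForm, binomialForm, Polynomial.map_sum]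
  refine sum_congr rfl fun k _ => ?_
  rw [Polynomial.map_mul, Polynomial.map_C, Polynomial.map_pow, Polynomial.map_X, map_mul, map_natCast,
    Complex.coe_algebraMap]

/-- Evaluating a binomial form. [cite: BorceaBranden2009II, §3 Example 1] -/
theorem eval_binomialForm {R : Type*} [CommSemiring R] (n : ℕ) (c : ℕ → R) (t : R) :
    (binomialForm n c).eval t = ∑ k ∈ range (n + 1), ((n.choose k : ℕ) : R) * c k * t ^ k := by
  rw [binomialForm, Polynomial.eval_finsetSum]
  simp only [Polynomial.eval_mul, Polynomial.eval_C, Polynomial.eval_pow, Polynomial.eval_X]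

/-- **The diagonal operator `Λ_b : t^k ↦ b_k t^k`** (so that `Λ_b(Σ binom(n,k) a_k t^k) = Σ binom(n,k) a_k b_k t^k`
is the Schur–Maló–Szegő composition). [cite: BorceaBranden2009II, §3 Example 1 (the Schur–Maló–Szegő
composition `Σ binom(n,k) a_k b_k z^k`)] -/
def multiplierOp (b : ℕ → ℂ) : Polynomial ℂ →ₗ[ℂ] Polynomial ℂ :=
  (Polynomial.basisMonomials ℂ).constr ℂ fun k => b k • Polynomial.monomial k 1

/-- `Λ_b(c t^k) = b_k c t^k`. [cite: BorceaBranden2009II, §3 Example 1] -/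
theorem multiplierOp_monomial (b : ℕ → ℂ) (k : ℕ) (c : ℂ) :
    multiplierOp b (Polynomial.monomial k c) = Polynomial.monomial k (b k * c) := by
  have h : (Polynomial.monomial k c : Polynomial ℂ) = c • Polynomial.basisMonomials ℂ k := by
    rw [Polynomial.coe_basisMonomials, Polynomial.smul_monomial, smul_eq_mul, mul_one]
  rw [h, map_smul, multiplierOp, Module.Basis.constr_basis, Polynomial.smul_monomial, Polynomial.smul_monomial,
    smul_eq_mul, smul_eq_mul, mul_one, mul_comm]

/-- `Λ_b(t^k) = b_k t^k`. [cite: BorceaBranden2009II, §3 Example 1] -/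
theorem multiplierOp_X_pow (b : ℕ → ℂ) (k : ℕ) :
    multiplierOp b (Polynomial.X ^ k) = Polynomial.C (b k) * Polynomial.X ^ k := by
  rw [Polynomial.C_mul_X_pow_eq_monomial, Polynomial.X_pow_eq_monomial, multiplierOp_monomial, mul_one]

/-- **`Λ_b` of a binomial form is the Schur–Maló–Szegő composition**:
`Λ_b(Σ binom(n,k) c_k t^k) = Σ binom(n,k) b_k c_k t^k`. [cite: BorceaBranden2009II, §3 Example 1] -/
theorem multiplierOp_binomialForm (b c : ℕ → ℂ) (n : ℕ) :
    multiplierOp b (binomialForm n c) = binomialForm n fun k => b k * c k := by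
  rw [binomialForm, binomialForm, map_sum]
  refine sum_congr rfl fun k _ => ?_
  rw [Polynomial.C_mul_X_pow_eq_monomial, Polynomial.C_mul_X_pow_eq_monomial, multiplierOp_monomial,
    mul_left_comm]

/-- **The symbol of `Λ_b` on `ℂ_n[t]`**: `Λ_b[(t+w)^n](z) = Σ_k binom(n,k) b_k z^k w^{n-k}`.
[cite: BorceaBranden2009, §1.1 (G_T(z,w) = Σ binom(κ,k) T(z^k) w^{κ-k})] -/
theorem eval_multiplierOp_X_add_C_pow (b : ℕ → ℂ) (n : ℕ) (z w : ℂ) :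
    (multiplierOp b ((Polynomial.X + Polynomial.C w) ^ n)).eval z =
      ∑ k ∈ range (n + 1), ((n.choose k : ℕ) : ℂ) * b k * z ^ k * w ^ (n - k) := by
  rw [apply_X_add_C_pow, Polynomial.eval_finsetSum]
  refine sum_congr rfl fun k _ => ?_
  rw [multiplierOp_X_pow, Polynomial.eval_smul, Polynomial.eval_mul, Polynomial.eval_C, Polynomial.eval_pow,
    Polynomial.eval_X, smul_eq_mul]
  ring

/-- `Σ_k binom(n,k) b_k z^k w^{n-k} = w^n q(z/w)` for `w ≠ 0`, `q(t) = Σ_k binom(n,k) b_k t^k` (the symbol of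
`Λ_b` is the homogenisation of `q`). [cite: BorceaBranden2009II, §3 Example 1 ("`g(z,w) = Σ binom(n,k)
b_{n-k} z^{n-k} w^k` … stable")] -/
theorem symbol_multiplierOp_eq (b : ℕ → ℂ) (n : ℕ) (z : ℂ) {w : ℂ} (hw : w ≠ 0) :
    ∑ k ∈ range (n + 1), ((n.choose k : ℕ) : ℂ) * b k * z ^ k * w ^ (n - k) =
      w ^ n * (binomialForm n b).eval (z / w) := by
  rw [eval_binomialForm, mul_sum]
  refine sum_congr rfl fun k hk => ?_
  have hk' : k ≤ n := Nat.lt_succ_iff.1 (mem_range.1 hk)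
  rw [pow_sub₀ _ hw hk', div_pow]
  simp only [div_eq_mul_inv]
  ring

/-- **`G_{Λ_b}(z,w) ≠ 0` on `Im z, Im w > 0`** when all zeros of `q(t) = Σ_k binom(n,k) b_k t^k` are real and
`≤ 0`: a zero would give `q(z/w) = 0`, i.e. `z = -rw` with `r ≥ 0`, contradicting `Im z > 0 < Im w`.
[cite: BorceaBranden2009II, §3 Example 1 ("all the zeros of the latter polynomial are non-positive then the
bivariate polynomial … `g(z,w)` … [is] stable")] -/
theorem symbol_multiplierOp_ne_zero {b : ℕ → ℂ} {n : ℕ}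
    (hq : ∀ t : ℂ, (binomialForm n b).eval t = 0 → t.im = 0 ∧ t.re ≤ 0) {z w : ℂ} (hz : 0 < z.im)
    (hw : 0 < w.im) : ∑ k ∈ range (n + 1), ((n.choose k : ℕ) : ℂ) * b k * z ^ k * w ^ (n - k) ≠ 0 := by
  have hw0 : w ≠ 0 := fun h => by simp [h] at hw
  rw [symbol_multiplierOp_eq b n z hw0]
  refine mul_ne_zero (pow_ne_zero n hw0) fun h0 => ?_
  obtain ⟨him, hre⟩ := hq _ h0
  have hu : z / w = (((z / w).re : ℝ) : ℂ) := Complex.ext (by simp) (by simp [him])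
  have hzw : z = (((z / w).re : ℝ) : ℂ) * w := by rw [← hu, div_mul_cancel₀ z hw0]
  have hz' : z.im = (z / w).re * w.im := by
    conv_lhs => rw [hzw]
    simp [Complex.mul_im]
  have : z.im ≤ 0 := by
    rw [hz']
    exact mul_nonpos_of_nonpos_of_nonneg hre hw.le
  exact absurd hz (not_lt.2 this)

/-- **`Λ_b` preserves stability on `ℂ_n[t]`** when `q(t) = Σ_k binom(n,k) b_k t^k` has only real non-positive
zeros: for every stable `p` of degree `≤ n`, `Λ_b(p)` is stable or `0` (Borcea–Brändén I, Thm. 1.1 (b) ⇒, with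
`G_{Λ_b}(z,w) = w^n q(z/w)` stable). [cite: BorceaBranden2009II, §3 Example 1 and Cor. 3.4 (a)]
[cite: BorceaBranden2009, §1.1 Thm. 1.1 ((b) ⇒ preserver), case n = 1] -/
theorem multiplierOp_stable_or_zero {b : ℕ → ℂ} {n : ℕ} (hn : 0 < n)
    (hq : ∀ t : ℂ, (binomialForm n b).eval t = 0 → t.im = 0 ∧ t.re ≤ 0) {p : Polynomial ℂ}
    (hp : p.natDegree ≤ n) (hs : ∀ t : ℂ, 0 < t.im → p.eval t ≠ 0) :
    (∀ t : ℂ, 0 < t.im → (multiplierOp b p).eval t ≠ 0) ∨ multiplierOp b p = 0 := by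
  have hG : IsUpperHalfPlaneStable (univariateSymbol n (multiplierOp b)) :=
    (isUpperHalfPlaneStable_univariateSymbol_iff n _).2 fun z w hz hw => by
      rw [eval_multiplierOp_X_add_C_pow]
      exact symbol_multiplierOp_ne_zero hq hz hw
  exact (boundedDegree_stabilityPreserver_iff hn (multiplierOp b)).2 (Or.inr hG) p hp hs

end Multiplier

/-! ## §2 The Schur–Maló–Szegő theorem -/

section SchurMaloSzego

/-- Complex conjugation commutes with evaluating a real polynomial. [cite: BorceaBranden2009, §1 proof of
Lemma 1.8 ("`|h(w̄)| = |conj h(w̄)|`" for real `h`)] -/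
theorem conj_eval_map_polynomial (f : Polynomial ℝ) (t : ℂ) :
    (starRingEnd ℂ) ((f.map (algebraMap ℝ ℂ)).eval t) = (f.map (algebraMap ℝ ℂ)).eval ((starRingEnd ℂ) t) := by
  rw [Polynomial.eval_map, Polynomial.eval_map, Polynomial.hom_eval₂,
    show (starRingEnd ℂ).comp (algebraMap ℝ ℂ) = algebraMap ℝ ℂ from RingHom.ext fun x => Complex.conj_ofReal x]

/-- **A real polynomial without zeros in the open upper half-plane has only real zeros** (zeros of real
polynomials come in conjugate pairs). [cite: BorceaBranden2009II, §3 Example 1 ("stable (that is,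
real-rooted)")] -/
theorem im_eq_zero_of_eval_eq_zero {f : Polynomial ℝ}
    (hs : ∀ t : ℂ, 0 < t.im → (f.map (algebraMap ℝ ℂ)).eval t ≠ 0) {t : ℂ}
    (ht : (f.map (algebraMap ℝ ℂ)).eval t = 0) : t.im = 0 := by
  rcases lt_trichotomy t.im 0 with h | h | h
  · exfalso
    refine hs ((starRingEnd ℂ) t) (by rw [Complex.conj_im]; linarith) ?_
    rw [← conj_eval_map_polynomial, ht, map_zero]
  · exact h
  · exact absurd ht (hs t h)

/-- **The Schur–Maló–Szegő theorem.** If `Σ_{k≤n} binom(n,k) a_k t^k` has only real zeros and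
`Σ_{k≤n} binom(n,k) b_k t^k` has only real non-positive zeros (`a_k, b_k ∈ ℝ`), then the Schur–Maló–Szegő
composition `Σ_{k≤n} binom(n,k) a_k b_k t^k` has only real zeros or is identically zero. (Zeros are taken in
`ℂ`; "has only real zeros" for a polynomial forces it to be nonzero. The alternative "identically zero"
occurs, e.g., for `n = 1`, `a = (0,1)`, `b = (1,0)`.) [cite: BorceaBranden2009II, §3 Example 1
(Schur–Maló–Szegő theorem)] -/
theorem schur_malo_szego {n : ℕ} {a b : ℕ → ℝ}
    (hp : ∀ t : ℂ, ((binomialForm n a).map (algebraMap ℝ ℂ)).eval t = 0 → t.im = 0)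
    (hq : ∀ t : ℂ, ((binomialForm n b).map (algebraMap ℝ ℂ)).eval t = 0 → t.im = 0 ∧ t.re ≤ 0) :
    binomialForm n (fun k => a k * b k) = 0 ∨
      ∀ t : ℂ, ((binomialForm n fun k => a k * b k).map (algebraMap ℝ ℂ)).eval t = 0 → t.im = 0 := by
  rcases Nat.eq_zero_or_pos n with rfl | hn
  · -- degree `0`: the composition is the constant `a₀ b₀`
    by_cases h0 : a 0 * b 0 = 0
    · left
      rw [binomialForm, zero_add, range_one, sum_singleton, Nat.choose_self, Nat.cast_one, one_mul, h0, map_zero,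
        zero_mul]
    · right
      intro t ht
      rw [map_binomialForm, eval_binomialForm, zero_add, range_one, sum_singleton] at ht
      simp only [Nat.choose_self, Nat.cast_one, one_mul, pow_zero, mul_one, Complex.ofReal_mul] at ht
      exact absurd (by exact_mod_cast ht : a 0 * b 0 = 0) h0
  · -- degree `n ≥ 1`: `Λ_b` preserves stability on `ℂ_n[t]`
    have hq' : ∀ t : ℂ, (binomialForm n fun k => (b k : ℂ)).eval t = 0 → t.im = 0 ∧ t.re ≤ 0 := fun t ht =>
      hq t (by rwa [map_binomialForm])
    have hs : ∀ t : ℂ, 0 < t.im → (binomialForm n fun k => (a k : ℂ)).eval t ≠ 0 := fun t ht h0 =>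
      absurd (hp t (by rwa [map_binomialForm])) ht.ne'
    have h := multiplierOp_stable_or_zero hn hq' (natDegree_binomialForm_le n _) hs
    rw [multiplierOp_binomialForm] at h
    have hr : (binomialForm n fun k => a k * b k).map (algebraMap ℝ ℂ) =
        binomialForm n fun k => (b k : ℂ) * (a k : ℂ) := by
      rw [map_binomialForm]
      simp only [Complex.ofReal_mul, mul_comm]
    rcases h with h | h
    · right
      intro t ht
      refine im_eq_zero_of_eval_eq_zero (f := binomialForm n fun k => a k * b k) (fun s hs' => ?_) ht
      rw [hr]
      exact h s hs'
    · left
      apply Polynomial.map_injective (algebraMap ℝ ℂ) (algebraMap ℝ ℂ).injective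
      rw [hr, h, Polynomial.map_zero]

end SchurMaloSzego

end Literature.Combinatorics.StablePolynomials

end
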